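import Mathlib.Data.Finset.Update
import Mathlib.Algebra.Order.BigOperators.Group.Finset
import Mathlib.Data.Real.Basic
import Mathlib.Data.Fintype.BigOperators
import Mathlib.Probability.Independence.Integration
import Mathlib.Analysis.SpecialFunctions.Pow.Real
import Mathlib.MeasureTheory.Integral.Bochner.Set
import Mathlib.MeasureTheory.Measure.Real
import Mathlib.MeasureTheory.Measure.Typeclasses.Probability
import Mathlib.MeasureTheory.Integral.Marginal
import Literature.MathematicalPhysics.QuantumFieldTheory.LatticeGaugeProofs
import Literature.MathematicalPhysics.QuantumFieldTheory.QCDPhaseQuenchedReweighting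
import Summits.QuantumFields.QCD.Theorems.ExtinctionBuildsQCD.Negative.VolumeLever
import Summits.QuantumFields.QCD.Theorems.ExtinctionBuildsQCD.Negative.InertiaPencil
import Summits.QuantumFields.QCD.Theorems.WindowExtinction.Negative.SpectralFlowLocal
import Summits.QuantumFields.QCD.Theorems.SpectralDefectExtinctionAFBookkeeping
import Summits.QuantumFields.QCD.Theorems.SpectralDefectExtinctionWindowExtinctionStubNegCountMeasurable
import Summits.QuantumFields.QCD.Theorems.SpectralDefectExtinctionWindowExtinctionStubImplantCost
import Summits.QuantumFields.QCD.Theorems.SpectralDefectExtinctionWindowExtinctionStubDetQuasilocal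
import Summits.QuantumFields.QCD.Theorems.SpectralDefectExtinctionWindowExtinctionStubLittlewoodOfford
import Summits.QuantumFields.QCD.Theorems.SpectralDefectExtinctionWindowExtinctionSpreadLayerCake
import Summits.QuantumFields.QCD.Theorems.SpectralDefectExtinctionWindowExtinctionSpreadTorusBoxes
import Summits.QuantumFields.QCD.Theorems.SpectralDefectExtinctionWindowExtinctionSpreadTelescope
import Summits.QuantumFields.QCD.Theorems.SpectralDefectExtinctionWindowExtinctionSpreadPattern
import Summits.QuantumFields.QCD.Theorems.SpectralDefectExtinctionWindowExtinctionSpreadMixtureOdds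
import Summits.QuantumFields.QCD.Theorems.SpectralDefectExtinctionWindowExtinctionStubAntichainWeight
import Summits.QuantumFields.QCD.Theorems.SpectralDefectExtinctionWindowExtinctionStubFiberAtomMonotone
import Summits.QuantumFields.QCD.Theorems.SpectralDefectExtinctionWindowExtinctionStubActiveCoresAbundant
import Summits.QuantumFields.QCD.Theorems.SpectralDefectExtinctionWindowExtinctionStubInertiaMonotone
import Summits.QuantumFields.QCD.Theorems.SpectralDefectExtinctionWindowExtinctionStubFluxTemplateHalfCycle
import Summits.QuantumFields.QCD.Theorems.SpectralDefectExtinctionWindowExtinctionStubFluxTemplateHalfSpectral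
import Summits.QuantumFields.QCD.Theorems.SpectralDefectExtinctionWindowExtinctionStubFluxTemplateHalf
import Summits.QuantumFields.QCD.Theorems.SpectralDefectExtinctionWindowExtinctionStubSpreadFromPartsR3Inlined
import Summits.QuantumFields.QCD.Theorems.SpectralDefectExtinctionWindowExtinctionStubSpreadFromPartsR3
import Summits.QuantumFields.QCD.Theorems.SpectralDefectExtinctionWindowExtinctionStubInertiaMonotoneWeak
import Summits.QuantumFields.QCD.Theorems.SpectralDefectExtinctionWindowExtinctionStubBoxBlockReindex
import Summits.QuantumFields.QCD.Theorems.SpectralDefectExtinctionWindowExtinctionStubNegCountOpen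
import Summits.QuantumFields.QCD.Theorems.SpectralDefectExtinctionWindowExtinctionStubBoxBlockCut
import Summits.QuantumFields.QCD.Theorems.SpectralDefectExtinctionWindowExtinctionStubIndexTemplateWeakOf
import Summits.QuantumFields.QCD.Theorems.SpectralDefectExtinctionWindowExtinctionPeriodicIndexCarrierOf
import HarnessLib

/-!
# Stub `stub_spreadOfCarrier` of line `hermitian-flow-coarea` (reshape r6): the periodic index carrier
# gives the fixed-coupling index spread `C⁺_sub` for every `N_f`

Crux `Summit.QuantumFields.QCD.Theses.SpectralDefectExtinction.TipPricing` (item stmt-QuantumFields-8967),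
line `hermitian-flow-coarea`, lead c4.  This file re-packages, for crux 8967, the composition
"periodic carrier ⇒ `C⁺_sub` for every `N_f`" of the sibling crux 8964 (`WindowExtinction`), lead c3
(`Cruxes/WindowExtinction/Lines/free_volume_heavy_witness_c3.lean`, §4b–§6: `templatePair_of'`,
`indexTemplateWeak_of`, `WindowExtinction_of`), over 8964's LANDED stubs, all in namespace
`Summit.QuantumFields.QCD.Cruxes.WindowExtinction.FreeVolumeHeavyWitness`:

* S12 `stub_indexTemplateWeak_of_inlined` over S8 `stub_boxBlockReindex`, S9 `stub_negCountOpen`,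
  S10 `stub_boxBlockCut` and the hypothesis (the periodic index carrier, S11) gives the WEAK
  index-carrying template class `Tp` (`carrier_indexTemplateWeak_of`);
* with the centre-flux class `Tm` of S5b-m `stub_fluxTemplateHalf` (box block invertible, inertia
  exactly half at `|δ| ≤ 1/4`) and the one-sided Haynsworth monotonicity S7′
  `stub_inertiaMonotoneWeak`, the two classes form a monotone template pair at every probe of every
  window `[lo, hi] ⊆ (0, 1/4]` — the skeleton's `templatePair_of'`, ported verbatim
  (`carrier_templatePair_of`);
* the landed end-game S6′ `stub_spreadFromPartsR3` over S1 `stub_negCountMeasurable`,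
  S2 `stub_implantCost`, S3 `stub_detQuasilocal`, S4′ `stub_antichainWeight`,
  S4″ `stub_fiberAtomMonotone`, S5a `stub_activeCoresAbundant` and that template pair is
  `FixedCouplingIndexSpreadSub N_f` for every `N_f` (`stub_spreadOfCarrier`).

The definitions `FixedCouplingIndexSpreadSub`, `TemplatePair`, `MonotonePair`, `negCount`, `tmplHaar`,
`boxRestrict`, `Tmpl` are the landed ones of
`Theorems/SpectralDefectExtinctionWindowExtinctionStubSpreadFromPartsR3.lean`.

Supports stmt-QuantumFields-8967 (stub `stub_spreadOfCarrier`, T3, of line `hermitian-flow-coarea`).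
No named facts, no `sorry`; axioms standard.
-/

noncomputable section

namespace Summit.QuantumFields.QCD.Cruxes.TipPricing.HermitianFlowCoarea

open scoped BigOperators Topology Classical MeasureTheory Matrix ComplexConjugate
open Filter MeasureTheory Matrix
open Literature.MathematicalPhysics.QuantumLattice Literature.MathematicalPhysics.QuantumFieldTheory
  Literature.Probability.LatticeModels
open Summit.QuantumFields.QCD.Theorems.ExtinctionBuildsQCD.Negative
open Summit.QuantumFields.QCD.Cruxes.WindowExtinction.FreeVolumeHeavyWitness

/-- **The weak index-carrying template from the periodic carrier** (8964-c3's `indexTemplateWeak_of`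
over the landed S8, S9, S10 and the def-free S12 `stub_indexTemplateWeak_of_inlined`): for every window
`0 < lo ≤ hi ≤ Q·lo`, `hi ≤ 1/4`, a radius `R` and a measurable, Haar-positive class `Tp` of box contents
such that every field whose box content lies in `Tp` has box block of `Γ₅ D_W(·, −δ, 1)` with at least
`6(2R+1)⁴ + 96(2R+1)³ + 1` negative eigenvalues at every probe `δ ∈ [lo, hi]`. -/
theorem carrier_indexTemplateWeak_of
    (hP : ∀ (Q : ℕ) (lo hi : ℝ), 0 < lo → lo ≤ hi → hi ≤ Q * lo → hi ≤ 1 / 4 →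
      ∃ (R : ℕ) (U₀ : GaugeConfig 4 (2 * R + 1) SU3), ∀ δ : ℝ, lo ≤ δ → δ ≤ hi →
        6 * (2 * R + 1) ^ 4 + 96 * (2 * R + 1) ^ 3 + 1 + 12 * ((2 * R + 1) ^ 4 - (2 * R - 1) ^ 4) ≤
          negRootCount (spinorLift gammaFive * wilsonDirac (fundamentalRep (Fin 3)) U₀ (-δ) 1)) :
    ∀ (Q : ℕ) (lo hi : ℝ), 0 < lo → lo ≤ hi → hi ≤ Q * lo → hi ≤ 1 / 4 →
      ∃ (R : ℕ) (Tp : Set ((↥(box 4 R) × Fin 4) → SU3)), MeasurableSet Tp ∧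
        (Measure.pi fun _ : ↥(box 4 R) × Fin 4 => haarProbability SU3) Tp ≠ 0 ∧
        ∀ δ : ℝ, lo ≤ δ → δ ≤ hi → ∀ (n : ℕ) [NeZero n], 2 * R + 1 < n →
          ∀ (c : Fin 4 → ℤ) (U : GaugeConfig 4 n SU3),
            (fun yi : ↥(box 4 R) × Fin 4 => U (Torus.proj n (c + (yi.1 : Fin 4 → ℤ)), yi.2)) ∈ Tp →
            6 * (2 * R + 1) ^ 4 + 96 * (2 * R + 1) ^ 3 + 1 ≤
              negRootCount ((spinorLift gammaFive * wilsonDirac (fundamentalRep (Fin 3)) U (-δ) 1).submatrix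
                (Subtype.val : {p : TorusSite 4 n × Fin 3 × Fin 4 //
                  ∃ y : ↥(box 4 R), Torus.proj n (c + (y : Fin 4 → ℤ)) = p.1} → _) Subtype.val) :=
  stub_indexTemplateWeak_of_inlined stub_boxBlockReindex stub_negCountOpen stub_boxBlockCut hP

/-- **Template pairs from the periodic carrier** (8964-c3's `templatePair_of'`, ported): at a window take
`(R, Tp)` from the weak index-carrying template (`carrier_indexTemplateWeak_of`) and the centre-flux class
`Tm` of the landed S5b-m `stub_fluxTemplateHalf` at that radius; for `δ ∈ [lo, hi] ⊆ (0, 1/4]` the `Tm`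
box block is invertible with `n₋ = 6(2R+1)⁴` and the `Tp` box block has `n₋ ≥ 6(2R+1)⁴ + 96(2R+1)³ + 1`,
so the landed S7′ `stub_inertiaMonotoneWeak` gives strict monotonicity of `negCount` under any `Tm → Tp`
swap of one box content, in every environment on every torus where the box embeds. -/
theorem carrier_templatePair_of
    (hP : ∀ (Q : ℕ) (lo hi : ℝ), 0 < lo → lo ≤ hi → hi ≤ Q * lo → hi ≤ 1 / 4 →
      ∃ (R : ℕ) (U₀ : GaugeConfig 4 (2 * R + 1) SU3), ∀ δ : ℝ, lo ≤ δ → δ ≤ hi →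
        6 * (2 * R + 1) ^ 4 + 96 * (2 * R + 1) ^ 3 + 1 + 12 * ((2 * R + 1) ^ 4 - (2 * R - 1) ^ 4) ≤
          negRootCount (spinorLift gammaFive * wilsonDirac (fundamentalRep (Fin 3)) U₀ (-δ) 1)) :
    TemplatePair := by
  intro Q lo hi hlo hlohi hQ hhi
  obtain ⟨R, Tp, hTp, hTp0, hW⟩ := carrier_indexTemplateWeak_of hP Q lo hi hlo hlohi hQ hhi
  obtain ⟨Tm, hTm, hTm0, hM⟩ := stub_fluxTemplateHalf R
  refine ⟨R, Tp, Tm, hTp, hTm, hTp0, hTm0, fun δ hδ1 hδ2 => ?_⟩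
  intro n _ hn c U U' hagree hUm hUp
  have hδ : |δ| ≤ 1 / 4 := by
    rw [abs_of_nonneg (hlo.le.trans hδ1)]
    exact hδ2.trans hhi
  obtain ⟨hdetm, hhalf⟩ := hM δ hδ n hn c U hUm
  have hge := hW δ hδ1 hδ2 n hn c U' hUp
  have hgap := stub_inertiaMonotoneWeak n R hn c δ U U' hagree hdetm (by rw [hhalf]; exact hge)
  simpa [negCount] using hgap

/-- **STUB T3 `stub_spreadOfCarrier`** (= `SpreadOfCarrier` of the skeleton of line `hermitian-flow-coarea`,
fully expanded): the periodic index carrier — for every window `0 < lo ≤ hi ≤ Q·lo`, `hi ≤ 1/4`, an odd torus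
side `2R+1` and an `SU(3)` field `U₀` on it with
`n₋(Γ₅ D_W(U₀, −δ, 1)) ≥ 6(2R+1)⁴ + 96(2R+1)³ + 1 + 12((2R+1)⁴ − (2R−1)⁴)` for all `δ ∈ [lo, hi]` — gives
the deep-subcritical fixed-coupling index spread `FixedCouplingIndexSpreadSub N_f` for EVERY `N_f`:
8964-c3's composition `stub_spreadFromPartsR3 S1 S2 S3 S4′ S4″ S5a (templatePair_of' S7′ S5b-m
(stub_indexTemplateWeak_of_inlined S8 S9 S10 carrier))` over its landed stubs. -/
theorem stub_spreadOfCarrier :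
    (∀ (Q : ℕ) (lo hi : ℝ), 0 < lo → lo ≤ hi → hi ≤ Q * lo → hi ≤ 1 / 4 →
      ∃ (R : ℕ) (U₀ : GaugeConfig 4 (2 * R + 1) SU3), ∀ δ : ℝ, lo ≤ δ → δ ≤ hi →
        6 * (2 * R + 1) ^ 4 + 96 * (2 * R + 1) ^ 3 + 1 + 12 * ((2 * R + 1) ^ 4 - (2 * R - 1) ^ 4) ≤
          negRootCount (spinorLift gammaFive * wilsonDirac (fundamentalRep (Fin 3)) U₀ (-δ) 1)) →
    ∀ Nf : ℕ, Summit.QuantumFields.QCD.Cruxes.WindowExtinction.FreeVolumeHeavyWitness.FixedCouplingIndexSpreadSub Nf := by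
  intro hP Nf
  exact stub_spreadFromPartsR3 stub_negCountMeasurable stub_implantCost stub_detQuasilocal
    stub_antichainWeight stub_fiberAtomMonotone stub_activeCoresAbundant (carrier_templatePair_of hP) Nf

end Summit.QuantumFields.QCD.Cruxes.TipPricing.HermitianFlowCoarea

end
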